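import Summits.ResolutionOfSingularities.ResolutionOfSingularities.Theorems.FrobeniusLadderFInjectiveMacaulayficationP2d4CChar2Fan
import Summits.ResolutionOfSingularities.ResolutionOfSingularities.Theorems.FrobeniusLadderFInjectiveMacaulayficationFCentreE1RungZero
import Summits.ResolutionOfSingularities.ResolutionOfSingularities.Theorems.FrobeniusLadderFInjectiveMacaulayficationFCentreE1ChartPresentation
import Summits.ResolutionOfSingularities.ResolutionOfSingularities.Theorems.FrobeniusLadderFInjectiveMacaulayficationGermOfPointFixable
import Summits.ResolutionOfSingularities.ResolutionOfSingularities.Theorems.FrobeniusLadderFInjectiveMacaulayficationPointFixableTransport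
import Summits.ResolutionOfSingularities.ResolutionOfSingularities.Theorems.FrobeniusLadderFInjectiveMacaulayficationLevelTwoBlockTranslate
import HarnessLib

/-!
# ★ THE P2d4C POSITIVE KERNEL INSTANCE: the origin of `z² + x⁴z + y³ + u³ + t³` (char 2, `d = 4`) is NOT FULL and IS germ-F-injectivised by ONE
# `𝔪`-primary monomial blow-up — the first INFORMATIVE positive row of the F-half census at `d = 4`, `p = 2` in the kernel
# (crux `FInjectiveMacaulayfication` stmt-ResolutionOfSingularities-15315, chain w45a; res-L1-w45a-plan-1 DEAL 06:12:34Z / ERRATUM 06:13:14Z;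
# certificate res-L1-w45a-idea-1 g19 FB5-r3 (c) `fb5r3/certs/P2d4C-tower13-toric-cert.json` f612183ca01f9afd; seat res-L1-w45a-stub-2 g7)

[OURS · L1 W4.5a] Support file (`--supports stmt-ResolutionOfSingularities-15315 --as helper`); def-free; replaces the role of NO printed item; NOT
a statement of the manuscript; AI-written (AI review is weaker than expert review). The mathematics of the certificate is res-L1-w45a-idea-1's
(regular tower «point ← (E₀)_red ← point» of FB5-r2 §4.2, composed to ONE monomial centre `I_A`, `|A| = 33`, 13 unimodular charts, every chart
F-pure at every point by a constant Fedder split class); the kernel checks are `P2d4CChar2Fan` (this seat); the frame is res-L1-w45a-stub-1's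
`RoadBFrame` (the T₁₁/7 road, p525959).

* §1 `p2d4c_originPointFixable (Gs) (hG : Gs 0 = f)` — `PFix₂(𝒪_{X,b})` at the origin `b` of `X = Spec k[X]/(Gs)`, in the `Set.range Gs` presentation
  of the frame (`RoadBFrame.originPointFixable_of_kernelChecks 2 k 5 13` on the binders of `P2d4CChar2Fan` BY NAME).
* §2 `p2d4c_germ (f) (hf) (v) (hv)` — **`GermForm.FInjectivizationGermAt 2 v`** at the vertex `v` of `Spec k[X]/(f)` (stub-1's presentation of the
  specimen): transport of §1 along `Spec` of `Ideal.quotEquivOfEq : k[X]/(span (range ![f])) ≃ k[X]/(span {f})` (`PointFixableTransport.pointFixable_of_ringEquiv`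
  on the stalk map of that isomorphism), then `GermOfPointFixable.fInjectivizationGermAt_of_pointFixable` with the isolatedness of
  `FCentreE1RungZero.regular_of_ne_vertex`.
* §3 ★★ `p2d4c_bad_germ_row` — **the census row «¬ FullCl 2 𝒪_{X,v} ∧ FInjectivizationGermAt 2 v» for EVERY field `k` of characteristic 2**
  (¬FULL half: res-L1-w45a-stub-1's `FCentreE1ChartWitness.p2d4c_vertex_not_fullCl`, p604021).
[folklore glue; OURS as a certificate; cite: Fedder1983, Prop. 1.7 and Thm. 1.12; StacksProject, Tag 0804; CoxLittleSchenck2011, §2.3]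
-/

-- single-problem summit: the doubled namespace component is forced
set_option linter.dupNamespace false

noncomputable section

open AlgebraicGeometry CategoryTheory Literature.AlgebraicGeometry.Resolution TopologicalSpace IsLocalRing MvPolynomial

namespace Summit.ResolutionOfSingularities.ResolutionOfSingularities.Theorems.FInjectiveMacaulayfication.P2d4CChar2Germ

open Summit.ResolutionOfSingularities.ResolutionOfSingularities.Theorems.FInjectiveMacaulayfication
open SliceableCentre GermForm FCentreE1ChartWitness FCentreE1ChartPresentation FCentreE1RungZero

/-! ## §1 `PFix₂` at the origin, in the frame's presentation `k[X]/(Set.range Gs)` -/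

set_option maxHeartbeats 800000 in
-- the frame's statement is large; instantiation is by name
/-- ★ **`PFix₂` AT THE ORIGIN OF `X = V(z² + x⁴z + y³ + u³ + t³)`, `char k = 2`** (the road-B frame on the kernel-checked 13-chart toric certificate): an
`𝔪`-primary `(c) ⊆ 𝒪_{X,b}` such that every local ring of `Bl_{(c)} 𝒪_{X,b}` over the closed point is a domain satisfying the CM + Frobenius-closed clause.
Stated over a variable `Gs : Fin 1 → k[X]` pinned by `hG` (the frame's `Set.range` presentation). [OURS; folklore glue] -/
theorem p2d4c_originPointFixable (k : Type) [Field k] [CharP k 2] (Gs : Fin 1 → MvPolynomial (Fin 5) k)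
    (hG : Gs 0 = X 4 ^ 2 + X 0 ^ 4 * X 4 + X 1 ^ 3 + X 2 ^ 3 + X 3 ^ 3) :
    ∀ b : Spec (.of (MvPolynomial (Fin 5) k ⧸ Ideal.span (Set.range Gs))),
      b.asIdeal = Ideal.span (Set.range fun j : Fin 5 => Ideal.Quotient.mk (Ideal.span (Set.range Gs)) (X j)) →
      ∃ (nc : ℕ) (c : Fin nc → (Spec (.of (MvPolynomial (Fin 5) k ⧸ Ideal.span (Set.range Gs)))).presheaf.stalk b),
        Ideal.span (Set.range c) ≠ ⊥ ∧ (Ideal.span (Set.range c)).radical =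
          IsLocalRing.maximalIdeal ((Spec (.of (MvPolynomial (Fin 5) k ⧸ Ideal.span (Set.range Gs)))).presheaf.stalk b) ∧
        ∀ (j : Fin nc) (𝔔 : PrimeSpectrum (Literature.AlgebraicGeometry.Resolution.blowupAlgebra (Ideal.span (Set.range c)) (c j))),
          𝔔.asIdeal.comap (algebraMap ((Spec (.of (MvPolynomial (Fin 5) k ⧸ Ideal.span (Set.range Gs)))).presheaf.stalk b)
            (Literature.AlgebraicGeometry.Resolution.blowupAlgebra (Ideal.span (Set.range c)) (c j))) =
            IsLocalRing.maximalIdeal ((Spec (.of (MvPolynomial (Fin 5) k ⧸ Ideal.span (Set.range Gs)))).presheaf.stalk b) →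
          IsDomain (Localization.AtPrime 𝔔.asIdeal) ∧ ∀ dd : ℕ, ringKrullDim (Localization.AtPrime 𝔔.asIdeal) = dd →
            ∀ s : Fin dd → Localization.AtPrime 𝔔.asIdeal, (Ideal.span (Set.range s)).radical.IsMaximal →
              RingTheory.Sequence.IsWeaklyRegular (Localization.AtPrime 𝔔.asIdeal) (List.ofFn s) ∧
              ∀ y : Localization.AtPrime 𝔔.asIdeal, (∃ e : ℕ, y ^ 2 ^ e ∈ Ideal.span
                ((fun z : Localization.AtPrime 𝔔.asIdeal => z ^ 2 ^ e) '' (Ideal.span (Set.range s) : Set (Localization.AtPrime 𝔔.asIdeal)))) →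
                y ∈ Ideal.span (Set.range s) := by
  haveI : Fact (Nat.Prime 2) := ⟨Nat.prime_two⟩
  have e : Gs = ![X 4 ^ 2 + X 0 ^ 4 * X 4 + X 1 ^ 3 + X 2 ^ 3 + X 3 ^ 3] := by
    funext l
    fin_cases l
    exact hG
  subst e
  set f : MvPolynomial (Fin 5) k := X 4 ^ 2 + X 0 ^ 4 * X 4 + X 1 ^ 3 + X 2 ^ 3 + X 3 ^ 3 with hf
  have hr : Set.range (![f] : Fin 1 → MvPolynomial (Fin 5) k) = {f} := LevelTwoBlockTranslate.range_vec_one f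
  have hfprime : (Ideal.span {f}).IsPrime := (Ideal.span_singleton_prime (prime_f k f hf).ne_zero).mpr (prime_f k f hf)
  have hpr : (Ideal.span (Set.range (![f] : Fin 1 → MvPolynomial (Fin 5) k))).IsPrime := by rw [hr]; exact hfprime
  have hXne : ∀ v : Fin 5, Ideal.Quotient.mk (Ideal.span (Set.range (![f] : Fin 1 → MvPolynomial (Fin 5) k))) (X v) ≠ 0 := by
    intro v h0
    have hmem : (X v : MvPolynomial (Fin 5) k) ∈ Ideal.span (Set.range (![f] : Fin 1 → MvPolynomial (Fin 5) k)) :=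
      Ideal.Quotient.eq_zero_iff_mem.mp h0
    rw [hr] at hmem
    by_cases hv : v = 1
    · subst hv
      refine mk_X_ne_zero_of_eval k f hfprime 1 (Pi.single 2 1) (by simp) ?_ (Ideal.Quotient.eq_zero_iff_mem.mpr hmem)
      rw [hf]; simp
    · refine mk_X_ne_zero_of_eval k f hfprime v (Pi.single 1 1) (Pi.single_eq_of_ne hv _) ?_ (Ideal.Quotient.eq_zero_iff_mem.mpr hmem)
      rw [hf]; simp
  have hf0 : constantCoeff f = 0 := constantCoeff_f k f hf
  exact RoadBFrame.originPointFixable_of_kernelChecks 2 k 5 13 P2d4CChar2Fan.ht P2d4CChar2Fan.A P2d4CChar2Fan.hprim P2d4CChar2Fan.hAJ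
    P2d4CChar2Fan.m (P2d4CChar2Fan.hcov k) P2d4CChar2Fan.V P2d4CChar2Fan.hV P2d4CChar2Fan.a P2d4CChar2Fan.haA P2d4CChar2Fan.hgen
    P2d4CChar2Fan.hge f hf0 hpr hXne P2d4CChar2Fan.G P2d4CChar2Fan.d (P2d4CChar2Fan.hθF₀ k) P2d4CChar2Fan.hunit (P2d4CChar2Fan.hv k _)
    (P2d4CChar2Fan.hg0 k) (P2d4CChar2Fan.hX k) P2d4CChar2Fan.CELLS P2d4CChar2Fan.hcheck P2d4CChar2Fan.hSS

/-! ## §2 Transport to the presentation `k[X]/(f)` and the germ form -/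

set_option maxHeartbeats 800000 in
-- two presentations of the same hypersurface; one stalk transport
/-- ★ **THE GERM FORM AT THE VERTEX OF P2d4C**: `GermForm.FInjectivizationGermAt 2 v` for the origin `v` of `X = Spec k[X]/(z² + x⁴z + y³ + u³ + t³)`, every
field `k` of characteristic 2 — a point-cosupported centre on `Spec 𝒪_{X,v}` ALL of whose blowings up are FULL at EVERY point. From §1 through `Spec` of
`Ideal.quotEquivOfEq` (stalk map = ring isomorphism; `PointFixableTransport.pointFixable_of_ringEquiv`) and `GermOfPointFixable.fInjectivizationGermAt_of_pointFixable`
(isolatedness `FCentreE1RungZero.regular_of_ne_vertex`). [OURS · certificate instance] -/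
theorem p2d4c_germ (k : Type) [Field k] [CharP k 2] (f : MvPolynomial (Fin 5) k)
    (hf : f = X 4 ^ 2 + X 0 ^ 4 * X 4 + X 1 ^ 3 + X 2 ^ 3 + X 3 ^ 3)
    (v : Spec (.of (MvPolynomial (Fin 5) k ⧸ Ideal.span {f})))
    (hv : v.asIdeal = Ideal.span (Set.range fun j : Fin 5 => Ideal.Quotient.mk (Ideal.span {f}) (X j))) :
    GermForm.FInjectivizationGermAt 2 v := by
  classical
  haveI : Fact (Nat.Prime 2) := ⟨Nat.prime_two⟩
  haveI hfprime : (Ideal.span {f}).IsPrime := (Ideal.span_singleton_prime (prime_f k f hf).ne_zero).mpr (prime_f k f hf)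
  haveI : IsDomain (MvPolynomial (Fin 5) k ⧸ Ideal.span {f}) := Ideal.Quotient.isDomain _
  haveI : IsIntegral (Spec (.of (MvPolynomial (Fin 5) k ⧸ Ideal.span {f}))) := isIntegral_p2d4c k f hf
  haveI := FermatCubicConeGerm.structureMorphism_locallyOfFiniteType k f
  -- the two presentations of the hypersurface
  have hI : Ideal.span (Set.range (![f] : Fin 1 → MvPolynomial (Fin 5) k)) = Ideal.span {f} := by rw [LevelTwoBlockTranslate.range_vec_one]
  let φ : (MvPolynomial (Fin 5) k ⧸ Ideal.span (Set.range (![f] : Fin 1 → MvPolynomial (Fin 5) k))) ≃+*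
      (MvPolynomial (Fin 5) k ⧸ Ideal.span {f}) := Ideal.quotEquivOfEq hI
  let ψ : Spec (.of (MvPolynomial (Fin 5) k ⧸ Ideal.span {f})) ⟶
      Spec (.of (MvPolynomial (Fin 5) k ⧸ Ideal.span (Set.range (![f] : Fin 1 → MvPolynomial (Fin 5) k)))) :=
    Spec.map φ.toCommRingCatIso.hom
  -- the origin `b₁ = ψ v` of the frame's presentation
  have hb₁ : (ψ v).asIdeal = Ideal.span (Set.range fun j : Fin 5 =>
      Ideal.Quotient.mk (Ideal.span (Set.range (![f] : Fin 1 → MvPolynomial (Fin 5) k))) (X j)) := by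
    change Ideal.comap φ.toRingHom v.asIdeal = _
    have hmap : (Ideal.span (Set.range fun j : Fin 5 =>
        Ideal.Quotient.mk (Ideal.span (Set.range (![f] : Fin 1 → MvPolynomial (Fin 5) k))) (X j))).map φ.toRingHom =
        Ideal.span (Set.range fun j : Fin 5 => Ideal.Quotient.mk (Ideal.span {f}) (X j)) := by
      rw [Ideal.map_span, ← Set.range_comp]
      rfl
    rw [hv, ← hmap]
    exact Ideal.comap_map_of_bijective φ.toRingHom φ.bijective
  have hfix₁ := p2d4c_originPointFixable k ![f] (by simp [hf]) (ψ v) hb₁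
  -- the stalk map of the isomorphism `ψ` at `v` is a ring isomorphism `𝒪_{b₁} ≅ 𝒪_{v}`
  have hfix₂ := PointFixableTransport.pointFixable_of_ringEquiv 2 (asIso (ψ.stalkMap v)).commRingCatIsoToRingEquiv hfix₁
  exact GermOfPointFixable.fInjectivizationGermAt_of_pointFixable 2
    (Spec.map (CommRingCat.ofHom (algebraMap k (MvPolynomial (Fin 5) k ⧸ Ideal.span {f})))) v (isClosed_vertex k f hf v hv)
    (regular_of_ne_vertex k f hf v hv) hfix₂

/-! ## §3 ★★ The census row -/

/-- ★★ **THE FIRST INFORMATIVE POSITIVE ROW OF THE F-HALF CENSUS AT `d = 4`, `p = 2` IN THE KERNEL** (census currency of res-L1-w45a-tri-2 #369 /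
res-L1-w45a-plan-1 R17.11): for every field `k` of characteristic 2 and the vertex `v` of `X = V(z² + x⁴z + y³ + u³ + t³) ⊂ 𝔸⁵_k` (an ISOLATED double point of
local dimension 4, `FCentreE1RungZero`), the local ring `𝒪_{X,v}` is NOT FULL (the parameter ideal `(x, y, u, t)` is not Frobenius closed — p604021) AND the germ
IS F-injectivised by a point-cosupported blowing up (the monomial centre `I_A` of res-L1-w45a-idea-1's certificate, 13 F-pure charts). The same specimen's
FIRST F-blowup candidate is refuted modulo LEMMA N (`FCentreE1TierOne`, p608942) — the cure here is a DIFFERENT (tower) centre. [OURS · certificate instance;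
cite: Fedder1983, Thm. 1.12] -/
theorem p2d4c_bad_germ_row (k : Type) [Field k] [CharP k 2] (f : MvPolynomial (Fin 5) k)
    (hf : f = X 4 ^ 2 + X 0 ^ 4 * X 4 + X 1 ^ 3 + X 2 ^ 3 + X 3 ^ 3)
    (v : Spec (.of (MvPolynomial (Fin 5) k ⧸ Ideal.span {f})))
    (hv : v.asIdeal = Ideal.span (Set.range fun j : Fin 5 => Ideal.Quotient.mk (Ideal.span {f}) (X j))) :
    ¬ FullCl 2 ((Spec (.of (MvPolynomial (Fin 5) k ⧸ Ideal.span {f}))).presheaf.stalk v) ∧ GermForm.FInjectivizationGermAt 2 v :=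
  ⟨p2d4c_vertex_not_fullCl k f hf v hv, p2d4c_germ k f hf v hv⟩

end Summit.ResolutionOfSingularities.ResolutionOfSingularities.Theorems.FInjectiveMacaulayfication.P2d4CChar2Germ

end
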